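import Literature.NumberTheory.EllipticCurves.NewformGaloisRepModLAssembly
import Literature.NumberTheory.EllipticCurves.NewformGaloisRepDeligneOfThm61Proofs
import Literature.NumberTheory.EllipticCurves.NewformGaloisRepModLProofs
import Literature.NumberTheory.EllipticCurves.NewformsLiftProofs
import Literature.NumberTheory.GaloisRepresentations.ResidualRepresentation
import Literature.RepresentationTheory.Semisimple.FinTwoSemisimplification
import Literature.RingTheory.DiscreteValuationRing.AdicCompletionResidueField
import HarnessLib

/-!
# The mod-`λ` Galois representation attached to a newform of weight `≥ 2`, along an arbitrary
# coefficient map `𝓞_f → κ`, from Deligne's theorem (Deligne–Serre 1974, Thm. 6.1 and 6.12)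

A *proofs* file (theorems only: no definition, no named fact, no `sorry`; D-0026).  The tree's
Serre-road and level-lowering files (`Automorphic/EdixhovenWeightMinimality`,
`Automorphic/WeightTwoNewformOrdinaryAtPInLevel`, `Automorphic/SerreConjecture`,
`EllipticCurves/RibetLevelRaising`, …) all speak of a mod-`p` representation
`ρ̄ : Γ_ℚ → GL₂(κ)` **attached to a newform `f` through a coefficient map `ι : 𝓞_f →+* κ`**
(`IsGaloisRepOfNewform1Int f ι {q ∣ N ℓ} ρ̄`), and take such a `ρ̄` as a HYPOTHESIS.  This file
PRODUCES it from the one printed statement of Deligne's theorem the tree uses as its Deligne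
input, `DeligneSerre1974.thm61_exists_adicGaloisRep` (*Formes modulaires de poids 1*, Thm. 6.1,
p. 520: `λ`-adic representations at EVERY finite place `λ`), by the printed reduction step 6.12
(op. cit. p. 522: "Quitte à remplacer `ρ_λ` par une représentation isomorphe, on peut supposer
que `ρ_λ(G) ⊂ GL₂(𝒪_λ)` … Par réduction (mod `λ`) on déduit de `ρ_λ` une représentation
`ρ̃_λ : G → GL₂(k_λ)` … Quitte à semi-simplifier `ρ̃_λ`, on peut supposer `ρ̃_λ` semi-simple"):

* `exists_isGaloisRepOfNewform1Int_semisimple_of_thm61` — GRANTED Thm. 6.1: for a newform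
  `f ∈ S_k(Γ₁(N))`, `k ≥ 2`, a prime `ℓ`, a field `κ` of characteristic `ℓ` with the discrete
  topology and ANY ring homomorphism `ι : 𝓞_f →+* κ` (`𝓞_f = coeffCharIntegers f`), there is a
  continuous SEMISIMPLE `ρ̄ : Γ_ℚ → GL₂(κ)`, unramified at the primes `p ∤ N ℓ`, whose arithmetic
  Frobenii there have characteristic polynomial `ι(X² − a_p X + ε(p) p^{k−1})`
  (`IsGaloisRepOfNewform1Int f ι {p ∣ N ℓ} ρ̄`).
* `exists_isGaloisRepOfNewform1Int_liftToGamma1_of_thm61` — the same for a newform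
  `g ∈ S_k(Γ₀(M))` (`IsNewform0 g`), through its lift `liftToGamma1 M k g` to `Γ₁(M)` (Li 1975;
  the tree's `isNewform1_liftToGamma1_iff_holds`), the shape in which `RibetLevelRaising`,
  `TorsionLevelLowering…` and the TQMP organ files consume it.

## Proof (6.12 of op. cit., with all glue proved in the tree)

Let `K = K_f = coeffCharField f ⊆ ℂ`; it is a number field (Deligne–Serre (2.7.2)–(2.7.3):
`IsNewform1.finiteDimensional_coeffField_of_span_integralLattice1` with the discharged
`DeligneSerre1974_span_integralLattice1_holds`, and `finiteDimensional_coeffCharField`), and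
`𝓞_f = integralClosure ℤ K_f` is (the type of) `𝓞 K`.  The kernel of `ι : 𝓞 K → κ` is a non-zero
prime (`κ` is a domain; `ι(ℓ) = 0`), i.e. a finite place `v` of `K`.  Thm. 6.1 for the eigenform
`f` of type `(k, ε_f)` with `a_p = a_p(f) ∈ K`, `c = ε_f` (`nebentypusCoeff`) at the place `v`
gives `ρ : Γ_ℚ → GL₂(K_v)` unramified at `p ∤ N`, `p ∉ v`, with
`det(X − ρ(F_p)) = X² − a_p X + ε(p) p^{k−1}` (exactly as in
`Ribet1977.thm21_exists_galoisRep_of_thm61`).  By compactness `ρ` has an integral model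
`ρ₀ : Γ_ℚ → GL₂(O_v)` (`GaloisRepresentations.exists_integralModel`); its reduction
`ρ₀ mod 𝔪_v : Γ_ℚ → GL₂(k_v)` has open kernel (`isOpen_ker_residualRep`); push it to `κ` along the
residue embedding `θ : k_v = 𝓞 K / v → κ` induced by `ι` (`residueFieldEquiv`,
`Ideal.Quotient.lift`), and semisimplify in `GL₂(κ)` keeping characteristic polynomials and
enlarging the kernel (`exists_semisimplification_fin_two`).  At a prime `p ∤ N ℓ` one has `p ∉ v`
(else `1 ∈ v`), the integral model is unramified where `ρ` is, and its Frobenius characteristic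
polynomial is the integral Hecke polynomial `X² − a_p X + ε(p) p^{k−1} ∈ 𝓞_f[X]` (`a_p`,
`ε(p) p^{k−1}` are algebraic integers: `IsNewform1.isIntegral_cuspCoeff`,
`isIntegral_nebentypus_mul_zpow`), whose reduction along `θ ∘ (mod 𝔪_v)` is its image under `ι`.

## References

* P. Deligne, J.-P. Serre, *Formes modulaires de poids 1*, Ann. Sci. ÉNS (4) 7 (1974), 507–530:
  Thm. 6.1 with (6.1.1) (p. 520), 6.12 (p. 522), footnote (1) p. 513 (arithmetic Frobenius),
  Prop. 2.7 (p. 512). [DeligneSerreASENS1974]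
* F. Diamond, J. Shurman, *A first course in modular forms*, GTM 228 (2005), Def. 9.6.4 and
  Thm. 9.6.5 (the `K_{f,λ}`-form), §9.6 p. 399 ("reduction of `ρ_{f,λ}` modulo `λ`").
  [DiamondShurman2005]
* H. Darmon, F. Diamond, R. Taylor, *Fermat's Last Theorem* (1995), §2.1 p. 54 and p. 87
  ("Define `ρ̄_f : G_ℚ → GL₂(k_f)` to be the semi-simplification of the reduction of `ρ_f`").
  [DarmonDiamondTaylor1995]
* W.-C. W. Li, *Newforms and functional equations*, Math. Ann. 212 (1975) (the `Γ₀ → Γ₁` lift).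
-/

noncomputable section

open scoped MatrixGroups ModularForm NumberField Polynomial

open CongruenceSubgroup UpperHalfPlane IsLocalRing IsDedekindDomain Polynomial Rat.HeightOneSpectrum
  Field

namespace Literature.NumberTheory.EllipticCurves.ModularForms.DeligneSerre1974

variable {N : ℕ} [NeZero N] {k : ℤ}

set_option maxHeartbeats 1600000 in
/-- **The mod-`λ` representation attached to a newform of weight `≥ 2`, along any coefficient map,
GRANTED Deligne's theorem** (Deligne–Serre 1974, Thm. 6.1 with the reduction step 6.12;
Diamond–Shurman Thm. 9.6.5 and §9.6; Darmon–Diamond–Taylor p. 87).  Let `f ∈ S_k(Γ₁(N))` be a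
newform, `k ≥ 2`, `ℓ` a prime, `κ` a field of characteristic `ℓ` (discrete topology) and
`ι : 𝓞_f →+* κ` a ring homomorphism (`λ = ker ι`).  Then there is a continuous semisimple
`ρ̄ : Gal(ℚ̄/ℚ) → GL₂(κ)`, unramified at every prime `p ∤ N ℓ`, such that every arithmetic
Frobenius at such `p` has characteristic polynomial `ι(X² − a_p X + ε(p) p^{k−1})`, i.e.
`IsGaloisRepOfNewform1Int f ι {p ∣ N ℓ} ρ̄`.  Proof = 6.12 of op. cit. at the place `v = ker ι`
of `K_f` (integral model by compactness, reduction mod `𝔪_v`, transport along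
`k_v = 𝓞_{K_f}/v ↪ κ`, semisimplification in `GL₂(κ)`); the hypothesis is the named fact
`thm61_exists_adicGaloisRep` verbatim.
[cite: DeligneSerreASENS1974, Thm. 6.1 (p. 520) and 6.12 (p. 522)]
[cite: DiamondShurman2005, Thm. 9.6.5] -/
theorem exists_isGaloisRepOfNewform1Int_semisimple_of_thm61 (h61 : thm61_exists_adicGaloisRep)
    (hk : 2 ≤ k) {f : CuspForm (Gamma1 N) k} (hf : IsNewform1 f)
    (ℓ : ℕ) [Fact ℓ.Prime] {κ : Type*} [Field κ] [CharP κ ℓ] [TopologicalSpace κ]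
    [DiscreteTopology κ] (ι : coeffCharIntegers f →+* κ) :
    ∃ ρ : GaloisRepresentations.FramedGaloisRep ℚ κ 2,
      IsGaloisRepOfNewform1Int f ι {p | p ∣ N * ℓ} ρ ∧ ρ.toGaloisRep.IsSemisimple := by
  classical
  have hℓ : ℓ.Prime := Fact.out
  have hk1 : 1 ≤ k := by omega
  -- ### `K = K_f` is a number field (Deligne–Serre (2.7.2)–(2.7.3), proved in the tree)
  haveI : FiniteDimensional ℚ (coeffField f) :=
    (IsNewform1.finiteDimensional_coeffField_of_span_integralLattice1
      (DeligneSerre1974_span_integralLattice1_holds N k)) hf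
  haveI : FiniteDimensional ℚ (coeffCharField f) :=
    DeligneSerre1974.finiteDimensional_coeffCharField f
  haveI : NumberField (coeffCharField f) := NumberField.mk
  -- ### the coefficient map on `𝓞 K_f` (the same ring as `𝓞_f`) and the place `v = ker ι`
  let ιO : 𝓞 (coeffCharField f) →+* κ := ι
  have hιO : ∀ y : coeffCharIntegers f, ιO y = ι y := fun _ ↦ rfl
  have hℓmem : ((ℓ : ℕ) : 𝓞 (coeffCharField f)) ∈ RingHom.ker ιO := by
    rw [RingHom.mem_ker, map_natCast, CharP.cast_eq_zero]
  have hne : RingHom.ker ιO ≠ ⊥ := by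
    intro h
    have h0 : ((ℓ : ℕ) : 𝓞 (coeffCharField f)) = 0 := by
      have h1 := hℓmem
      rw [h, Ideal.mem_bot] at h1
      exact h1
    exact hℓ.ne_zero (Nat.cast_eq_zero.mp h0)
  let v : HeightOneSpectrum (𝓞 (coeffCharField f)) :=
    ⟨RingHom.ker ιO, RingHom.ker_isPrime ιO, hne⟩
  have hvmem : ∀ r : 𝓞 (coeffCharField f), r ∈ v.asIdeal ↔ ιO r = 0 := fun r ↦ RingHom.mem_ker
  have hℓv : ((ℓ : ℕ) : 𝓞 (coeffCharField f)) ∈ v.asIdeal := hℓmem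
  have hpv : ∀ p : ℕ, p.Prime → ¬ p ∣ N * ℓ → ((p : ℕ) : 𝓞 (coeffCharField f)) ∉ v.asIdeal :=
    fun p hp hpNℓ ↦ natCast_not_mem_of_prime_ne v ℓ hp hℓ
      (fun h ↦ hpNℓ (h ▸ dvd_mul_left ℓ N)) hℓv
  -- ### Deligne's representation over `K_v` (Thm. 6.1 for the eigenform `f` of type `(k, ε_f)`)
  let e : coeffCharField f →+* ℂ := algebraMap (coeffCharField f) ℂ
  let a : ℕ → coeffCharField f := fun n ↦ ⟨cuspCoeff f n, cuspCoeff_mem_coeffCharField f n⟩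
  let c : ZMod N → coeffCharField f := fun d ↦ nebentypusCoeff f d
  have hc : ∀ d, e (c d) = nebentypus f d := fun d ↦ rfl
  have hfW : f ∈ nebentypusSubspace N k (nebentypus f) :=
    IsNewform1.mem_nebentypusSubspace_nebentypus_holds hf
  have hT : ∀ (p : ℕ) (hp : p.Prime), ¬ p ∣ N →
      (haveI : NeZero p := ⟨hp.ne_zero⟩; heckeT (Gamma1 N) k p f) = e (a p) • f := by
    intro p hp _
    haveI : NeZero p := ⟨hp.ne_zero⟩
    rw [heckeT_eq_heckeEigenvalue_smul f p (hf.2.1 p hp),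
      IsNewform1.heckeEigenvalue_eq_coeff_holds hf hp]
    rfl
  obtain ⟨ρ, -, hρ⟩ :=
    h61 N k hk f (nebentypus f) hfW hf.ne_zero (coeffCharField f) e a c hc hT v
  -- ### 6.12: an integral model over `O_v` and its reduction
  set O : ValuationSubring (v.adicCompletion (coeffCharField f)) :=
    v.adicCompletionIntegers (coeffCharField f) with hOdef
  haveI : IsPrincipalIdealRing O := inferInstance
  have hOopen : IsOpen ((O : Set (v.adicCompletion (coeffCharField f)))) :=
    Valued.isOpen_valuationSubring _
  obtain ⟨P, ρ₀, hρ₀⟩ := GaloisRepresentations.exists_integralModel (O := O) hOopen ρ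
  have hmax : {x : v.adicCompletion (coeffCharField f) |
      ∃ h : x ∈ O, (⟨x, h⟩ : O) ∈ maximalIdeal O} =
      {x : v.adicCompletion (coeffCharField f) | Valued.v x < 1} := by
    ext x
    simp only [Set.mem_setOf_eq]
    constructor
    · rintro ⟨hx, hm⟩
      rw [IsLocalRing.mem_maximalIdeal, mem_nonunits_iff,
        HeightOneSpectrum.adicCompletionIntegers.isUnit_iff_valued_eq_one] at hm
      exact lt_of_le_of_ne hx hm
    · intro hx
      refine ⟨le_of_lt hx, ?_⟩
      rw [IsLocalRing.mem_maximalIdeal, mem_nonunits_iff,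
        HeightOneSpectrum.adicCompletionIntegers.isUnit_iff_valued_eq_one]
      exact hx.ne
  have hmopen : IsOpen {x : v.adicCompletion (coeffCharField f) |
      ∃ h : x ∈ O, (⟨x, h⟩ : O) ∈ maximalIdeal O} := by
    rw [hmax]
    simpa only [Valuation.restrict_lt_one_iff] using
      Valued.isOpen_ball (v.adicCompletion (coeffCharField f)) 1
  set φbar : absoluteGaloisGroup ℚ →* GL (Fin 2) (ResidueField O) :=
    (Matrix.GeneralLinearGroup.map (residue O)).comp ρ₀ with hφbar
  have hφker : IsOpen (φbar.ker : Set (absoluteGaloisGroup ℚ)) :=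
    GaloisRepresentations.isOpen_ker_residualRep hmopen hρ₀
  -- ### the residue embedding `θ : k_v = 𝓞 K / v → κ` induced by `ι`
  have hlift : ∀ r ∈ v.asIdeal, ιO r = 0 := fun r hr ↦ (hvmem r).mp hr
  let θ : ResidueField O →+* κ :=
    (Ideal.Quotient.lift v.asIdeal ιO hlift).comp
      (HeightOneSpectrum.residueFieldEquiv (coeffCharField f) v).symm.toRingHom
  have hθ : ∀ r : 𝓞 (coeffCharField f),
      θ (residue O (algebraMap (𝓞 (coeffCharField f)) O r)) = ιO r := by
    intro r
    change Ideal.Quotient.lift v.asIdeal ιO hlift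
      ((HeightOneSpectrum.residueFieldEquiv (coeffCharField f) v).symm
        (residue O (algebraMap (𝓞 (coeffCharField f)) O r))) = ιO r
    rw [← HeightOneSpectrum.residueFieldEquiv_apply_mk, RingEquiv.symm_apply_apply,
      Ideal.Quotient.lift_mk]
  -- ### transport to `GL₂(κ)` and semisimplification
  set φκ : absoluteGaloisGroup ℚ →* GL (Fin 2) κ :=
    (Matrix.GeneralLinearGroup.map θ).comp φbar with hφκ
  have hφκchar : ∀ σ, ((φκ σ : GL (Fin 2) κ) : Matrix (Fin 2) (Fin 2) κ).charpoly =
      (((ρ₀ σ : GL (Fin 2) O) : Matrix (Fin 2) (Fin 2) O).charpoly).map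
        (θ.comp (residue O)) := by
    intro σ
    rw [← Matrix.charpoly_map]
    rfl
  have hkerκ : φbar.ker ≤ φκ.ker := by
    intro x hx
    rw [MonoidHom.mem_ker] at hx ⊢
    rw [hφκ, MonoidHom.comp_apply, hx, map_one]
  obtain ⟨φss, hφss, hφsschar, hφssker⟩ :=
    Literature.RepresentationTheory.Semisimple.exists_semisimplification_fin_two φκ
  have hker₂ : φbar.ker ≤ φss.ker := hkerκ.trans hφssker
  have hsubinj : Function.Injective (Matrix.GeneralLinearGroup.map (n := Fin 2) O.subtype) :=
    generalLinearGroup_map_injective_of_injective O.subtype Subtype.val_injective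
  have hchain : ∀ σ, ρ σ = 1 → φss σ = 1 := by
    intro σ hσ
    have h1 : ρ₀ σ = 1 := hsubinj (by rw [hρ₀, hσ, mul_one, inv_mul_cancel, map_one])
    exact hker₂ (show φbar σ = 1 by rw [hφbar, MonoidHom.comp_apply, h1, map_one])
  let ρbar : GaloisRepresentations.FramedGaloisRep ℚ κ 2 :=
    ⟨φss, continuous_of_isOpen_of_le_ker φss φbar.ker hφker hker₂⟩
  have hρbar : ∀ σ, ρbar σ = φss σ := fun _ ↦ rfl
  -- ### the integral Hecke polynomial `X² − a_p X + ε(p) p^{k−1} ∈ 𝓞_f[X]`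
  have hL := DeligneSerre1974_span_integralLattice1_holds N k
  let aInt : ℕ → coeffCharIntegers f := fun p ↦
    ⟨a p, (isIntegral_coeffCharField_iff f).mpr (IsNewform1.isIntegral_cuspCoeff hL hk1 hf p)⟩
  let cInt : ℕ → coeffCharIntegers f := fun p ↦
    ⟨⟨(nebentypus f (p : ZMod N) : ℂ) * (p : ℂ) ^ (k - 1), nebentypus_mul_zpow_mem_coeffCharField f p⟩,
      (isIntegral_coeffCharField_iff f).mpr (isIntegral_nebentypus_mul_zpow f hk1 p)⟩
  have hcInt : ∀ p : ℕ, ((cInt p : coeffCharIntegers f) : coeffCharField f) =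
      c (p : ℕ) * ((p : ℕ) : coeffCharField f) ^ (k - 1) := by
    intro p
    apply (algebraMap (coeffCharField f) ℂ).injective
    rw [map_mul, map_zpow₀, map_natCast (algebraMap (coeffCharField f) ℂ)]
    rfl
  let Pint : ℕ → Polynomial (coeffCharIntegers f) := fun p ↦ X ^ 2 - C (aInt p) * X + C (cInt p)
  have hPint : ∀ p : ℕ, (Pint p).map (algebraMap (coeffCharIntegers f) (coeffCharField f)) =
      heckePolynomial f p := by
    intro p
    simp only [Pint, heckePolynomial, Polynomial.map_add, Polynomial.map_sub,
      Polynomial.map_mul, Polynomial.map_pow, Polynomial.map_X, Polynomial.map_C]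
    rfl
  -- ### Frobenius characteristic polynomials of `φss` at the primes `p ∤ N ℓ`
  have hfrob : ∀ (w : HeightOneSpectrum (𝓞 ℚ)),
      ((primesEquiv w : Nat.Primes) : ℕ) ∉ {p : ℕ | p ∣ N * ℓ} →
      ∀ 𝔓 ∈ w.primesAbove, ∀ σ : absoluteGaloisGroup ℚ, IsArithFrobAt (𝓞 ℚ) σ 𝔓 →
        ((φss σ : GL (Fin 2) κ) : Matrix (Fin 2) (Fin 2) κ).charpoly =
          (Pint ((primesEquiv w : Nat.Primes) : ℕ)).map ι := by
    intro w hw 𝔓 h𝔓 σ hσ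
    set p : ℕ := ((primesEquiv w : Nat.Primes) : ℕ) with hpdef
    have hp : p.Prime := (primesEquiv w).2
    have hpNℓ : ¬ p ∣ N * ℓ := hw
    have hpN : ¬ p ∣ N := fun h ↦ hpNℓ (h.mul_right ℓ)
    obtain ⟨-, hchar⟩ := hρ w hpN (hpv p hp hpNℓ)
    have hcσ := hchar 𝔓 h𝔓 σ hσ
    -- the integral polynomial over `O_v` and `charpoly (ρ₀ σ)`
    let Q₀ : Polynomial O :=
      X ^ 2 - C (algebraMap (𝓞 (coeffCharField f)) O (aInt p)) * X +
        C (algebraMap (𝓞 (coeffCharField f)) O (cInt p))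
    have hcoeA : O.subtype (algebraMap (𝓞 (coeffCharField f)) O (aInt p)) =
        algebraMap (coeffCharField f) (v.adicCompletion (coeffCharField f)) (a p) := rfl
    have hcoeC : O.subtype (algebraMap (𝓞 (coeffCharField f)) O (cInt p)) =
        algebraMap (coeffCharField f) (v.adicCompletion (coeffCharField f))
          (c (p : ℕ) * ((p : ℕ) : coeffCharField f) ^ (k - 1)) := by
      rw [← hcInt]
      rfl
    have hQ₀ : Q₀.map O.subtype =
        ((X ^ 2 - C (a p) * X + C (c (p : ℕ) * ((p : ℕ) : coeffCharField f) ^ (k - 1))).map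
          (algebraMap (coeffCharField f) (v.adicCompletion (coeffCharField f)))) := by
      simp only [Q₀, Polynomial.map_add, Polynomial.map_sub, Polynomial.map_mul,
        Polynomial.map_pow, Polynomial.map_X, Polynomial.map_C, hcoeA, hcoeC]
    have h0 : ((ρ₀ σ : GL (Fin 2) O) : Matrix (Fin 2) (Fin 2) O).charpoly = Q₀ := by
      apply Polynomial.map_injective O.subtype Subtype.val_injective
      rw [GaloisRepresentations.charpoly_integralModel hρ₀ σ, hQ₀]
      exact hcσ
    -- reduction along `θ ∘ (mod 𝔪_v)`
    have hredA : θ (residue O (algebraMap (𝓞 (coeffCharField f)) O (aInt p))) = ι (aInt p) :=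
      hθ _
    have hredC : θ (residue O (algebraMap (𝓞 (coeffCharField f)) O (cInt p))) = ι (cInt p) :=
      hθ _
    rw [hφsschar σ, hφκchar σ, h0]
    simp only [Q₀, Pint, Polynomial.map_add, Polynomial.map_sub, Polynomial.map_mul,
      Polynomial.map_pow, Polynomial.map_X, Polynomial.map_C, RingHom.comp_apply, hredA, hredC]
  -- ### the mod-`λ` representation
  refine ⟨ρbar, fun w hw ↦ ⟨?_, Pint _, hPint _, ?_⟩, hφss⟩
  · -- unramified at `p ∤ N ℓ`
    intro 𝔓 h𝔓 σ hσ
    have hpN : ¬ ((primesEquiv w : Nat.Primes) : ℕ) ∣ N := fun h ↦ hw (h.mul_right ℓ)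
    obtain ⟨hunr, -⟩ := hρ w hpN (hpv _ (primesEquiv w).2 hw)
    rw [hρbar]
    exact hchain σ (hunr 𝔓 h𝔓 σ hσ)
  · -- Frobenius characteristic polynomials
    intro 𝔓 h𝔓 σ hσ
    change ((φss σ : GL (Fin 2) κ) : Matrix (Fin 2) (Fin 2) κ).charpoly = _
    exact hfrob w hw 𝔓 h𝔓 σ hσ

/-- **The mod-`λ` representation attached to a newform on `Γ₀(M)`, GRANTED Deligne's theorem.**
For a newform `g ∈ S_k(Γ₀(M))` (`IsNewform0 g`), `k ≥ 2`, a prime `ℓ`, a field `κ` of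
characteristic `ℓ` (discrete) and any `ι : 𝓞_{g} →+* κ` (coefficient integers of the lift
`liftToGamma1 M k g ∈ S_k(Γ₁(M))`, a newform with trivial nebentypus — Li 1975, the tree's
`isNewform1_liftToGamma1_iff_holds`): a continuous semisimple `ρ̄ : Gal(ℚ̄/ℚ) → GL₂(κ)` with
`IsGaloisRepOfNewform1Int (liftToGamma1 M k g) ι {p ∣ M ℓ} ρ̄` — the hypothesis shape of
`RibetLevelRaising`, `Automorphic.serreWeight_le_add_one_of_weightTwo_newform`, ….
[cite: DeligneSerreASENS1974, Thm. 6.1 (p. 520) and 6.12 (p. 522)] -/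
theorem exists_isGaloisRepOfNewform1Int_liftToGamma1_of_thm61 (h61 : thm61_exists_adicGaloisRep)
    {M : ℕ} [NeZero M] (hk : 2 ≤ k) {g : CuspForm (Gamma0 M) k} (hg : IsNewform0 g)
    (ℓ : ℕ) [Fact ℓ.Prime] {κ : Type*} [Field κ] [CharP κ ℓ] [TopologicalSpace κ]
    [DiscreteTopology κ] (ι : coeffCharIntegers (liftToGamma1 M k g) →+* κ) :
    ∃ ρ : GaloisRepresentations.FramedGaloisRep ℚ κ 2,
      IsGaloisRepOfNewform1Int (liftToGamma1 M k g) ι {p | p ∣ M * ℓ} ρ ∧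
        ρ.toGaloisRep.IsSemisimple :=
  exists_isGaloisRepOfNewform1Int_semisimple_of_thm61 h61 hk
    ((isNewform1_liftToGamma1_iff_holds M k g).mpr hg) ℓ ι

end Literature.NumberTheory.EllipticCurves.ModularForms.DeligneSerre1974

end
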